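import Literature.NumberTheory.DiophantineApproximation.PolylogHermitePadeRational
import Literature.NumberTheory.DiophantineApproximation.PolylogHermitePadeForms
import Literature.NumberTheory.DiophantineApproximation.DilogHermitePadeRationalArithmetic
import HarnessLib

/-!
# Every-weight Hermite–Padé forms at rational points: integrality and size of the coefficients

Topic `Literature/NumberTheory/DiophantineApproximation`. For partial-fraction data `c` of the
weight-`w` kernel (`d_n^{w−1−o} c_{o,p} ∈ ℤ`, `BallRivoal.IsInt`), the coefficients of the form
`M^n S^{(w)}_n(M/N) = ∑_{o<w} a^ℚ_o Li_{o+1}(M/N) + a^ℚ` (`PolylogPade.coefWQ`,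
`PolylogPade.constWQ` of `PolylogHermitePadeRational.lean`) become integers after multiplication
by `d_n^w` (`isInt_lcmUpto_pow_mul_coefWQ`, `isInt_lcmUpto_pow_mul_constWQ`;
`d_n = lcm(1..n) = Nat.lcmUpto n`), and `|a^ℚ_o| ≤ (∑|c|)·N^n` for `1 ≤ M ≤ N`
(`abs_coefWQ_le`, through `N^p M^{n−p} ≤ N^n`). This is the rational-point (`x = M/N`) version of
`PolylogHermitePadeForms.lean` (the case `M = 1`), with the same proofs.

References: T. Rivoal, C. R. Acad. Sci. Paris 331 (2000), §2 Lemme 5 (the integrality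
mechanism); S. David, N. Hirata-Kohno, M. Kawashima, Moscow J. Comb. Number Th. 9 (2020), Thm 2.1.
-/

noncomputable section

open Finset

namespace Literature.NumberTheory.DiophantineApproximation

namespace PolylogPade

open Literature.NumberTheory.Transcendental

/-- **Integrality of the `Li`-coefficients at `M/N`**: `d_n^w · a^ℚ_o ∈ ℤ` for `o < w`, from
`d_n^{w−1−o} c_{o,p} ∈ ℤ` (the factors `N^p M^{n−p}` are integers).
[cite: DavidHirataKohnoKawashima2020, Thm 2.1] -/
theorem isInt_lcmUpto_pow_mul_coefWQ {w n : ℕ} {c : ℕ → ℕ → ℚ}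
    (hc : BallRivoal.IsInt w (Nat.lcmUpto n) c) (N M : ℕ) {o : ℕ} (ho : o < w) :
    ∃ z : ℤ, ((Nat.lcmUpto n : ℚ) ^ w) * coefWQ n c N M o = z := by
  classical
  -- each summand is an integer
  have hterm : ∀ p ∈ range (n + 1),
      ∃ z : ℤ, ((Nat.lcmUpto n : ℚ) ^ w) * (c o p * (N : ℚ) ^ p * (M : ℚ) ^ (n - p)) = z := by
    intro p _
    obtain ⟨z, hz⟩ := hc o p
    refine ⟨z * (Nat.lcmUpto n : ℤ) ^ (o + 1) * (N : ℤ) ^ p * (M : ℤ) ^ (n - p), ?_⟩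
    have hw : w = (w - 1 - o) + (o + 1) := by omega
    rw [hw, pow_add]
    push_cast
    rw [← hz]
    ring
  choose! z hz using hterm
  refine ⟨∑ p ∈ range (n + 1), z p, ?_⟩
  rw [coefWQ, mul_sum, Int.cast_sum]
  exact sum_congr rfl fun p hp => hz p hp

/-- **Integrality of the constant term at `M/N`**: `d_n^w · a^ℚ ∈ ℤ`, from
`d_n^{w−1−o} c_{o,p} ∈ ℤ` and `m^{o+1} ∣ d_n^{o+1}` for `1 ≤ m ≤ p ≤ n` (`N ≥ 1`): each summand is
`(d_n^{w−1−o} c_{o,p}) · (d_n/m)^{o+1} · N^{p−m} · M^{n−p} M^m`.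
[cite: DavidHirataKohnoKawashima2020, Thm 2.1] -/
theorem isInt_lcmUpto_pow_mul_constWQ {w n : ℕ} {c : ℕ → ℕ → ℚ}
    (hc : BallRivoal.IsInt w (Nat.lcmUpto n) c) {N : ℕ} (hN : 1 ≤ N) (M : ℕ) :
    ∃ z : ℤ, ((Nat.lcmUpto n : ℚ) ^ w) * constWQ n w c N M = z := by
  classical
  have hN0 : (N : ℚ) ≠ 0 := by exact_mod_cast (show N ≠ 0 by omega)
  -- each elementary summand `c_{o,p} N^p M^{n-p} M^m/(N^m m^{o+1})` becomes an integer
  have hterm : ∀ o ∈ range w, ∀ p ∈ range (n + 1), ∀ m ∈ Icc 1 p,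
      ∃ z : ℤ, ((Nat.lcmUpto n : ℚ) ^ w) *
        (c o p * ((N : ℚ) ^ p * (M : ℚ) ^ (n - p) *
          ((M : ℚ) ^ m / ((N : ℚ) ^ m * (m : ℚ) ^ (o + 1))))) = z := by
    intro o ho p hp m hm
    rw [mem_range] at ho hp
    rw [mem_Icc] at hm
    obtain ⟨z, hz⟩ := hc o p
    obtain ⟨e, he⟩ : m ∣ Nat.lcmUpto n :=
      Int.natCast_dvd_natCast.1 (DilogPade.natCast_dvd_lcmUpto hm.1 (by omega : m ≤ n))
    have hm0 : (m : ℚ) ≠ 0 := by exact_mod_cast (show m ≠ 0 by omega)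
    refine ⟨z * (e : ℤ) ^ (o + 1) * (N : ℤ) ^ (p - m) * ((M : ℤ) ^ (n - p) * (M : ℤ) ^ m), ?_⟩
    have hw : w = (w - 1 - o) + (o + 1) := by omega
    have hpm : p = (p - m) + m := by omega
    have hd : (Nat.lcmUpto n : ℚ) = (m : ℚ) * e := by exact_mod_cast he
    have hd' : (Nat.lcmUpto n : ℚ) ^ (o + 1) = (m : ℚ) ^ (o + 1) * (e : ℚ) ^ (o + 1) := by
      rw [hd, mul_pow]
    have hNp : (N : ℚ) ^ p = (N : ℚ) ^ (p - m) * (N : ℚ) ^ m := by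
      rw [← pow_add, ← hpm]
    rw [hw, pow_add, hd', hNp]
    push_cast
    rw [← hz]
    field_simp
  -- sum them up
  have hsum : ∃ z : ℤ, ((Nat.lcmUpto n : ℚ) ^ w) *
      (∑ o ∈ range w, ∑ p ∈ range (n + 1),
        c o p * ∑ m ∈ Icc 1 p, (N : ℚ) ^ p * (M : ℚ) ^ (n - p) *
          ((M : ℚ) ^ m / ((N : ℚ) ^ m * (m : ℚ) ^ (o + 1)))) = z := by
    have h1 : ∀ o ∈ range w, ∀ p ∈ range (n + 1), ∃ z : ℤ, ((Nat.lcmUpto n : ℚ) ^ w) *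
        (c o p * ∑ m ∈ Icc 1 p, (N : ℚ) ^ p * (M : ℚ) ^ (n - p) *
          ((M : ℚ) ^ m / ((N : ℚ) ^ m * (m : ℚ) ^ (o + 1)))) = z := by
      intro o ho p hp
      choose! z hz using hterm o ho p hp
      refine ⟨∑ m ∈ Icc 1 p, z m, ?_⟩
      rw [mul_sum, mul_sum, Int.cast_sum]
      exact sum_congr rfl fun m hm => hz m hm
    have h2 : ∀ o ∈ range w, ∃ z : ℤ, ((Nat.lcmUpto n : ℚ) ^ w) *
        (∑ p ∈ range (n + 1), c o p *
          ∑ m ∈ Icc 1 p, (N : ℚ) ^ p * (M : ℚ) ^ (n - p) *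
            ((M : ℚ) ^ m / ((N : ℚ) ^ m * (m : ℚ) ^ (o + 1)))) = z := by
      intro o ho
      choose! z hz using h1 o ho
      refine ⟨∑ p ∈ range (n + 1), z p, ?_⟩
      rw [mul_sum, Int.cast_sum]
      exact sum_congr rfl fun p hp => hz p hp
    choose! z hz using h2
    refine ⟨∑ o ∈ range w, z o, ?_⟩
    rw [mul_sum, Int.cast_sum]
    exact sum_congr rfl fun o ho => hz o ho
  obtain ⟨z, hz⟩ := hsum
  refine ⟨-z, ?_⟩
  rw [constWQ, mul_neg, hz, Int.cast_neg]

/-- **Size of the `Li`-coefficients at `M/N`**: `|a^ℚ_o| ≤ (∑_{o,p} |c_{o,p}|) · N^n` for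
`1 ≤ M ≤ N`, `o < w` (through `N^p M^{n−p} ≤ N^n`). [folklore] -/
theorem abs_coefWQ_le {w n : ℕ} (c : ℕ → ℕ → ℚ) {N M : ℕ} (hM : 1 ≤ M) (hMN : M ≤ N)
    {o : ℕ} (ho : o < w) :
    |coefWQ n c N M o| ≤ BallRivoal.l1 n w c * (N : ℚ) ^ n := by
  calc |coefWQ n c N M o|
      ≤ ∑ p ∈ range (n + 1), |c o p * (N : ℚ) ^ p * (M : ℚ) ^ (n - p)| :=
        abs_sum_le_sum_abs _ _
    _ ≤ ∑ p ∈ range (n + 1), |c o p| * (N : ℚ) ^ n := by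
        refine sum_le_sum fun p hp => ?_
        have hp' : p ≤ n := Nat.lt_succ_iff.1 (mem_range.1 hp)
        have hpow : (N : ℚ) ^ p * (M : ℚ) ^ (n - p) ≤ (N : ℚ) ^ n := by
          exact_mod_cast DilogPade.pow_mul_pow_sub_le_pow hMN hp'
        rw [mul_assoc, abs_mul,
          abs_of_nonneg (by positivity : (0 : ℚ) ≤ (N : ℚ) ^ p * (M : ℚ) ^ (n - p))]
        exact mul_le_mul_of_nonneg_left hpow (abs_nonneg _)
    _ = (∑ p ∈ range (n + 1), |c o p|) * (N : ℚ) ^ n := by rw [sum_mul]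
    _ ≤ BallRivoal.l1 n w c * (N : ℚ) ^ n := by
        refine mul_le_mul_of_nonneg_right ?_ (by positivity)
        rw [BallRivoal.l1]
        calc ∑ p ∈ range (n + 1), |c o p|
            = ∑ p ∈ range (n + 1), ∑ o' ∈ ({o} : Finset ℕ), |c o' p| := by simp
          _ ≤ ∑ p ∈ range (n + 1), ∑ o' ∈ range w, |c o' p| :=
              sum_le_sum fun p _ => sum_le_sum_of_subset_of_nonneg
                (by simpa using ho) fun _ _ _ => abs_nonneg _

end PolylogPade

end Literature.NumberTheory.DiophantineApproximation
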